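import Literature.Computability.AlgebraicComplexity.PermanentIrreducible
import Summits.ValiantsHypothesis.ValiantsHypothesis.Theorems.SymPencilEquivariantSdcNotQPPermifyReduction
import Summits.ValiantsHypothesis.ValiantsHypothesis.Theorems.SymPencilEquivariantSdcNotQPCanonicalPair
import Summits.ValiantsHypothesis.ValiantsHypothesis.Theorems.SymPencilEquivariantSdcNotQPCompressionData
import HarnessLib

/-!
# ValiantsHypothesis / SymPencil — crux `EquivariantSdcNotQP` (stmt-ValiantsHypothesis-17792), line
# `birth_EquivariantSdcNotQP`: open piece (ii′) `FiniteConjugationLift` of `stub_permify` — PROVED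

`finiteConjugationLift` proves, CHARACTER FOR CHARACTER, the hypothesis `h₂` of
`permify_of_finiteLift_of_permEmbedding` (`…PermifyReduction.lean`, «Open pieces (ii′)»): a
conjugation-equivariant affine pencil `B` of size `m` for `per_n` (every pair of row/column
permutations lifts, `B(x_{π i, ρ j}) = g⁻¹ B(x) g`) can be replaced by a pencil `B₀` of size
`m₀ ≤ m` with `det B₀ = per_n` carried by a subgroup `F ≤ (𝔖_n × 𝔖_n) × GL_{m₀}(ℂ)` over every
`(π, ρ)`, with unimodular matrices and SCALAR fibre over `(1, 1)` — a finite central extension of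
`𝔖_n × 𝔖_n`.  Consequently the registered stub `stub_permify` of the line now rests on the single
representation-theoretic piece (iii′) `PermEmbeddingQP` (Young's rule and degree bounds for
`𝔖_n × 𝔖_n` and its double covers; not in Mathlib).

Proof (Parts A–C: `…InvariantSubspaceDets`, `…CanonicalPair`, `…CompressionData`):
`det B = per_n` is irreducible for `n ≥ 1` (`perPoly_irreducible`, von zur Gathen), so the pencil has
a canonical pair `U < W⋆` of invariant subspaces (least `per_n`-carrying / largest proper below it),
fixed by every lift; the COMPRESSION `B₁ = [π] B [ι]` of `B` to a complement `C` of `U` in `W⋆`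
(`m₀ = dim C ≤ m`) has affine entries and `P_U · det B₁ = P_{W⋆}`, whence `det B₁ = κ · per_n`
with `κ ≠ 0` (units of `ℂ[x]` are constants) and a scalar rescaling `B₀ = λ B₁`, `λ^{m₀} κ = 1`,
gives `det B₀ = per_n`; each lift `g` of `(π, ρ)` compresses to an invertible `h₀ = [π g ι]` with
`B₀(a) h₀ = h₀ B₀(a ∘ (π × ρ))` (compression is multiplicative on maps preserving `U` and `W⋆`),
normalised to determinant one by an `m₀`-th root; the pairs `((π, ρ), k)` with `B₀(x_{π i, ρ j}) =
k⁻¹ B₀ k`, `det k = 1` form a subgroup whose fibre over `(1,1)` commutes with every `B₀(a)`, hence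
is scalar (Schur on `W⋆/U`); `n = 0` is the empty pencil.  Helper, 0 definitions / 0 named facts.

Honest framing: `stub_permify` (= (iii′) now), the crux and `VP ≠ VNP` remain OPEN; no progress on them.
-/

noncomputable section

set_option linter.dupNamespace false

namespace Summit.ValiantsHypothesis.ValiantsHypothesis.Theorems.SymPencilEquivariantSdcNotQP

open Module Submodule

section Assembly

open MvPolynomial Matrix Literature.Computability.AlgebraicComplexity

/-- **Open piece (ii′) `FiniteConjugationLift` of `stub_permify` — PROVED.**  (The statement is the
hypothesis `h₂` of `permify_of_finiteLift_of_permEmbedding`, character for character.)  A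
conjugation-equivariant affine pencil `B` of size `m` for `per_n` (all pairs of row/column
permutations lift, `B(x_{π i, ρ j}) = g⁻¹ B(x) g`) can be replaced by the COMPRESSION `B₀` of `B`
to the simple subquotient `W⋆/U` of the canonical pair (Part B) — size `m₀ ≤ m`, affine,
`det B₀ = per_n` after a scalar rescaling — on which the lifts, transported through `W⋆` and `U`
(both canonical, hence fixed) and normalised to determinant one, form a subgroup
`F ≤ (𝔖_n × 𝔖_n) × GL_{m₀}(ℂ)` over every `(π, ρ)` whose fibre over `(1,1)` is SCALAR (Schur's lemma
on the simple subquotient: an eigenspace of a commuting endomorphism is an invariant subspace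
strictly between `U` and `W⋆` unless it is everything).  Uses `perPoly_irreducible`
(von zur Gathen) for `n ≥ 1`; `n = 0` is the empty pencil. [folklore] -/
theorem finiteConjugationLift :
    ∀ (n m : ℕ) (B : Matrix (Fin m) (Fin m) (MvPolynomial (Fin n × Fin n) ℂ)),
      IsAffineDetRepr (perPoly (Fin n) ℂ) B →
      (∃ c : ℂ, c ≠ 0 ∧
        B.map (MvPolynomial.eval fun _ => (1 : ℂ)) = c • (1 : Matrix (Fin m) (Fin m) ℂ)) →
      (∀ π ρ : Equiv.Perm (Fin n), ∃ g : GL (Fin m) ℂ,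
        B.map (MvPolynomial.rename fun ij : Fin n × Fin n => (π ij.1, ρ ij.2)) =
          ((g⁻¹ : GL (Fin m) ℂ) : Matrix (Fin m) (Fin m) ℂ).map MvPolynomial.C * B *
            (g : Matrix (Fin m) (Fin m) ℂ).map MvPolynomial.C) →
      ∃ m₀ ≤ m, ∃ (B₀ : Matrix (Fin m₀) (Fin m₀) (MvPolynomial (Fin n × Fin n) ℂ))
        (F : Subgroup ((Equiv.Perm (Fin n) × Equiv.Perm (Fin n)) × GL (Fin m₀) ℂ)),
        IsAffineDetRepr (perPoly (Fin n) ℂ) B₀ ∧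
        (∀ π ρ : Equiv.Perm (Fin n), ∃ g : GL (Fin m₀) ℂ, ((π, ρ), g) ∈ F) ∧
        (∀ g : GL (Fin m₀) ℂ, ((1 : Equiv.Perm (Fin n) × Equiv.Perm (Fin n)), g) ∈ F →
          ∃ c : ℂ, (g : Matrix (Fin m₀) (Fin m₀) ℂ) = c • (1 : Matrix (Fin m₀) (Fin m₀) ℂ)) ∧
        (∀ x ∈ F, Matrix.det (x.2 : Matrix (Fin m₀) (Fin m₀) ℂ) = 1) ∧
        (∀ x ∈ F, B₀.map (MvPolynomial.rename fun ij : Fin n × Fin n => (x.1.1 ij.1, x.1.2 ij.2)) =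
          ((x.2⁻¹ : GL (Fin m₀) ℂ) : Matrix (Fin m₀) (Fin m₀) ℂ).map MvPolynomial.C * B₀ *
            (x.2 : Matrix (Fin m₀) (Fin m₀) ℂ).map MvPolynomial.C) := by
  classical
  intro n m B hB _hBJ hgen
  -- the renaming attached to a pair of permutations, and its multiplicativity
  let Fr : Equiv.Perm (Fin n) × Equiv.Perm (Fin n) → (Fin n × Fin n → Fin n × Fin n) :=
    fun πρ ij => (πρ.1 ij.1, πρ.2 ij.2)
  have hFr_one : Fr 1 = id := by funext ij; simp [Fr]
  have hFr_mul : ∀ x y : Equiv.Perm (Fin n) × Equiv.Perm (Fin n), Fr (x * y) = Fr x ∘ Fr y := by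
    intro x y; funext ij; simp [Fr, Equiv.Perm.mul_apply]
  -- the lift subgroup of ANY pencil `B₀` (used for both cases)
  have mkF : ∀ (m₀ : ℕ) (B₀ : Matrix (Fin m₀) (Fin m₀) (MvPolynomial (Fin n × Fin n) ℂ)),
      ∃ F : Subgroup ((Equiv.Perm (Fin n) × Equiv.Perm (Fin n)) × GL (Fin m₀) ℂ),
        ∀ x, x ∈ F ↔ (B₀.map (MvPolynomial.rename (Fr x.1)) =
          ((x.2⁻¹ : GL (Fin m₀) ℂ) : Matrix (Fin m₀) (Fin m₀) ℂ).map MvPolynomial.C * B₀ *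
            (x.2 : Matrix (Fin m₀) (Fin m₀) ℂ).map MvPolynomial.C ∧
          Matrix.det (x.2 : Matrix (Fin m₀) (Fin m₀) ℂ) = 1) := by
    intro m₀ B₀
    let P : (Equiv.Perm (Fin n) × Equiv.Perm (Fin n)) × GL (Fin m₀) ℂ → Prop := fun x =>
      B₀.map (MvPolynomial.rename (Fr x.1)) =
          ((x.2⁻¹ : GL (Fin m₀) ℂ) : Matrix (Fin m₀) (Fin m₀) ℂ).map MvPolynomial.C * B₀ *
            (x.2 : Matrix (Fin m₀) (Fin m₀) ℂ).map MvPolynomial.C ∧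
        Matrix.det (x.2 : Matrix (Fin m₀) (Fin m₀) ℂ) = 1
    have hmul : ∀ {x y}, P x → P y → P (x * y) := ?hmul
    have hone : P 1 := ?hone
    have hinv : ∀ {x}, P x → P x⁻¹ := ?hinv
    · exact ⟨Subgroup.mk (Submonoid.mk (Subsemigroup.mk (setOf P) (fun hx hy => hmul hx hy)) hone)
        (fun hx => hinv hx), fun x => Iff.rfl⟩
    case hmul =>
      rintro x y ⟨hx, hxd⟩ ⟨hy, hyd⟩
      refine ⟨?_, ?_⟩
      · rw [Prod.fst_mul, hFr_mul, ← map_rename_rename, hy, map_rename_sandwich, hx, Prod.snd_mul,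
          _root_.mul_inv_rev, Units.val_mul, Units.val_mul, Matrix.map_mul, Matrix.map_mul]
        simp only [Matrix.mul_assoc]
      · rw [Prod.snd_mul, Units.val_mul, Matrix.det_mul, hxd, hyd, mul_one]
    case hone =>
      refine ⟨?_, ?_⟩
      · rw [Prod.fst_one, hFr_one, MvPolynomial.rename_id]
        simp only [AlgHom.coe_id, Matrix.map_id, Prod.snd_one, inv_one, Units.val_one]
        rw [Matrix.map_one _ (map_zero _) (map_one _), Matrix.one_mul, Matrix.mul_one]
      · rw [Prod.snd_one, Units.val_one, Matrix.det_one]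
    case hinv =>
      rintro x ⟨hx, hxd⟩
      refine ⟨?_, ?_⟩
      · -- apply `rename (Fr x.1⁻¹)` to `hx`
        have h := congrArg (fun M => M.map (MvPolynomial.rename (Fr x.1⁻¹))) hx
        rw [map_rename_rename, ← hFr_mul, inv_mul_cancel, hFr_one, MvPolynomial.rename_id,
          map_rename_sandwich] at h
        simp only [AlgHom.coe_id, Matrix.map_id] at h
        -- `h : B₀ = x⁻¹ (B₀.map _) x`; solve for the middle
        rw [Prod.fst_inv, Prod.snd_inv, inv_inv]
        have hginv : ((x.2⁻¹ : GL (Fin m₀) ℂ) : Matrix (Fin m₀) (Fin m₀) ℂ).map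
            (MvPolynomial.C : ℂ →+* MvPolynomial (Fin n × Fin n) ℂ) *
            (x.2 : Matrix (Fin m₀) (Fin m₀) ℂ).map MvPolynomial.C = 1 := by
          rw [← Matrix.map_mul, Units.inv_mul, Matrix.map_one _ (map_zero _) (map_one _)]
        have hginv' : (x.2 : Matrix (Fin m₀) (Fin m₀) ℂ).map
            (MvPolynomial.C : ℂ →+* MvPolynomial (Fin n × Fin n) ℂ) *
            ((x.2⁻¹ : GL (Fin m₀) ℂ) : Matrix (Fin m₀) (Fin m₀) ℂ).map MvPolynomial.C = 1 := by
          rw [← Matrix.map_mul, Units.mul_inv, Matrix.map_one _ (map_zero _) (map_one _)]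
        symm
        calc (x.2 : Matrix (Fin m₀) (Fin m₀) ℂ).map MvPolynomial.C * B₀ *
              ((x.2⁻¹ : GL (Fin m₀) ℂ) : Matrix (Fin m₀) (Fin m₀) ℂ).map MvPolynomial.C
            = (x.2 : Matrix (Fin m₀) (Fin m₀) ℂ).map MvPolynomial.C *
                (((x.2⁻¹ : GL (Fin m₀) ℂ) : Matrix (Fin m₀) (Fin m₀) ℂ).map MvPolynomial.C *
                  B₀.map (MvPolynomial.rename (Fr x.1⁻¹)) *
                  (x.2 : Matrix (Fin m₀) (Fin m₀) ℂ).map MvPolynomial.C) *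
              ((x.2⁻¹ : GL (Fin m₀) ℂ) : Matrix (Fin m₀) (Fin m₀) ℂ).map MvPolynomial.C := by
              rw [← h]
          _ = ((x.2 : Matrix (Fin m₀) (Fin m₀) ℂ).map MvPolynomial.C *
                ((x.2⁻¹ : GL (Fin m₀) ℂ) : Matrix (Fin m₀) (Fin m₀) ℂ).map MvPolynomial.C) *
                B₀.map (MvPolynomial.rename (Fr x.1⁻¹)) *
                ((x.2 : Matrix (Fin m₀) (Fin m₀) ℂ).map MvPolynomial.C *
                  ((x.2⁻¹ : GL (Fin m₀) ℂ) : Matrix (Fin m₀) (Fin m₀) ℂ).map MvPolynomial.C) := by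
              simp only [Matrix.mul_assoc]
          _ = B₀.map (MvPolynomial.rename (Fr x.1⁻¹)) := by
              rw [hginv', Matrix.one_mul, Matrix.mul_one]
      · have h1 := congrArg Matrix.det (Units.inv_mul x.2)
        rw [Matrix.det_mul, hxd, mul_one, Matrix.det_one] at h1
        rw [Prod.snd_inv]
        exact h1
  rcases Nat.eq_zero_or_pos n with hn | hn
  · -- `n = 0`: the empty pencil
    subst hn
    obtain ⟨F, hF⟩ := mkF 0 1
    refine ⟨0, Nat.zero_le _, 1, F, ⟨fun i => Fin.elim0 i, ?_⟩, ?_, ?_, ?_, ?_⟩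
    · rw [Matrix.det_one]
      simp [perPoly, Matrix.permanent]
    · intro π ρ
      refine ⟨1, (hF _).2 ⟨?_, ?_⟩⟩
      · ext i j; exact Fin.elim0 i
      · exact Matrix.det_isEmpty
    · intro g _
      exact ⟨1, by ext i j; exact Fin.elim0 i⟩
    · intro x hx; exact ((hF x).1 hx).2
    · intro x hx; exact ((hF x).1 hx).1
  -- `n ≥ 1`: the permanent is irreducible
  haveI : Nonempty (Fin n) := ⟨⟨0, hn⟩⟩
  have hdetB : B.det = perPoly (Fin n) ℂ := hB.2
  have hirr : Irreducible B.det := by rw [hdetB]; exact perPoly_irreducible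
  set T : (Fin n × Fin n → ℂ) → ((Fin m → ℂ) →ₗ[ℂ] (Fin m → ℂ)) :=
    fun a => Matrix.toLin' (B.map (MvPolynomial.eval a)) with hT
  obtain ⟨Wst, U, hWst, hU, hUlt, ⟨Pst, hPst, hdst⟩, ⟨PU, hPU, huU⟩, hUmax, htrans⟩ :=
    exists_canonical_pair B hirr
  obtain ⟨C, πC, hCW, hπC, hπU, hπW, hdim, hfac⟩ := exists_compression_data (K := ℂ) hUlt.le
  set m₀ : ℕ := Module.finrank ℂ C with hm₀
  let bC : Module.Basis (Fin m₀) ℂ C := Module.finBasis ℂ C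
  have hm₀pos : 0 < m₀ := by
    have := Submodule.finrank_lt_finrank_of_lt hUlt
    omega
  have hm₀le : m₀ ≤ m := by
    have := Submodule.finrank_le C
    rw [Module.finrank_fin_fun] at this
    exact this
  -- the compressed pencil
  set B₁ : Matrix (Fin m₀) (Fin m₀) (MvPolynomial (Fin n × Fin n) ℂ) :=
    (LinearMap.toMatrix (Pi.basisFun ℂ (Fin m)) bC πC).map
        (MvPolynomial.C : ℂ →+* MvPolynomial (Fin n × Fin n) ℂ) * B *
      (LinearMap.toMatrix bC (Pi.basisFun ℂ (Fin m)) C.subtype).map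
        (MvPolynomial.C : ℂ →+* MvPolynomial (Fin n × Fin n) ℂ) with hB₁
  have hB₁eval : ∀ a, B₁.map (MvPolynomial.eval a) =
      LinearMap.toMatrix bC bC (πC ∘ₗ T a ∘ₗ C.subtype) :=
    fun a => compression_map_eval B bC πC C.subtype a
  have hB₁aff : ∀ i j, (B₁ i j).totalDegree ≤ 1 := fun i j =>
    totalDegree_mul_map_C_apply_le _ _ (fun c d => totalDegree_map_C_mul_apply_le _ _ hB.1 c d) i j
  -- `PU · det B₁ = P_{W⋆}`
  have hdet1 : PU * B₁.det = Pst := by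
    refine MvPolynomial.funext fun a => ?_
    rw [map_mul, hPU a, hPst a, hB₁, eval_det_compression, hfac (T a) (hWst a) (hU a)]
  -- `det B₁ = κ · per_n` with `κ ≠ 0`
  obtain ⟨u, hu, hPUu⟩ := (MvPolynomial.isUnit_iff_eq_C_of_isReduced).mp huU
  obtain ⟨q, hq⟩ := hdst
  obtain ⟨q', hq'⟩ := poly_restrict_dvd_det B hWst hPst
  have hqunit : IsUnit q := by
    have hne : B.det ≠ 0 := hirr.ne_zero
    have : B.det * (q * q') = B.det * 1 := by rw [mul_one, ← mul_assoc, ← hq, ← hq']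
    exact IsUnit.of_mul_eq_one _ (mul_left_cancel₀ hne this)
  obtain ⟨v, hv, hqv⟩ := (MvPolynomial.isUnit_iff_eq_C_of_isReduced).mp hqunit
  have hune : u ≠ 0 := hu.ne_zero
  have hvne : v ≠ 0 := hv.ne_zero
  have hdetB₁ : B₁.det = MvPolynomial.C (v * u⁻¹) * perPoly (Fin n) ℂ := by
    have h : MvPolynomial.C u * B₁.det = B.det * MvPolynomial.C v := by
      rw [← hPUu, hdet1, hq, hqv]
    have hCu : (MvPolynomial.C u : MvPolynomial (Fin n × Fin n) ℂ) ≠ 0 := by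
      rwa [Ne, MvPolynomial.C_eq_zero]
    apply mul_left_cancel₀ hCu
    rw [h, hdetB, ← mul_assoc, ← map_mul, mul_comm u, mul_assoc, inv_mul_cancel₀ hune, mul_one, mul_comm]
  obtain ⟨lam, hlam⟩ := IsAlgClosed.exists_pow_nat_eq ((v * u⁻¹)⁻¹ : ℂ) hm₀pos
  have hvu : (v * u⁻¹ : ℂ) ≠ 0 := mul_ne_zero hvne (inv_ne_zero hune)
  set B₀ : Matrix (Fin m₀) (Fin m₀) (MvPolynomial (Fin n × Fin n) ℂ) :=
    (MvPolynomial.C lam : MvPolynomial (Fin n × Fin n) ℂ) • B₁ with hB₀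
  have hB₀aff : ∀ i j, (B₀ i j).totalDegree ≤ 1 := by
    intro i j
    rw [hB₀, Matrix.smul_apply, smul_eq_mul]
    exact (MvPolynomial.totalDegree_mul _ _).trans (by rw [MvPolynomial.totalDegree_C, zero_add]; exact hB₁aff i j)
  have hB₀det : B₀.det = perPoly (Fin n) ℂ := by
    rw [hB₀, Matrix.det_smul, Fintype.card_fin, hdetB₁, ← map_pow, hlam, ← mul_assoc, ← map_mul,
      inv_mul_cancel₀ hvu, map_one, one_mul]
  have hB₀eval : ∀ a, B₀.map (MvPolynomial.eval a) =
      lam • LinearMap.toMatrix bC bC (πC ∘ₗ T a ∘ₗ C.subtype) := by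
    intro a; rw [hB₀, smul_map_eval, hB₁eval]
  have hlamne : lam ≠ 0 := by
    rintro rfl
    rw [zero_pow hm₀pos.ne'] at hlam
    exact inv_ne_zero hvu hlam.symm
  -- the lift over a pair of permutations
  have hlift : ∀ πρ : Equiv.Perm (Fin n) × Equiv.Perm (Fin n), ∃ k : GL (Fin m₀) ℂ,
      B₀.map (MvPolynomial.rename (Fr πρ)) =
        ((k⁻¹ : GL (Fin m₀) ℂ) : Matrix (Fin m₀) (Fin m₀) ℂ).map MvPolynomial.C * B₀ *
          (k : Matrix (Fin m₀) (Fin m₀) ℂ).map MvPolynomial.C ∧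
      Matrix.det (k : Matrix (Fin m₀) (Fin m₀) ℂ) = 1 := by
    intro πρ
    obtain ⟨g, hg⟩ := hgen πρ.1 πρ.2
    have hg' : B.map (MvPolynomial.rename (Fr πρ)) =
        ((g⁻¹ : GL (Fin m) ℂ) : Matrix (Fin m) (Fin m) ℂ).map MvPolynomial.C * B *
          (g : Matrix (Fin m) (Fin m) ℂ).map MvPolynomial.C := hg
    have hgg : (g : Matrix (Fin m) (Fin m) ℂ) * ((g⁻¹ : GL (Fin m) ℂ) : Matrix (Fin m) (Fin m) ℂ) = 1 :=
      Units.mul_inv g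
    have hgg' : ((g⁻¹ : GL (Fin m) ℂ) : Matrix (Fin m) (Fin m) ℂ) * (g : Matrix (Fin m) (Fin m) ℂ) = 1 :=
      Units.inv_mul g
    -- the linear automorphism `G = g`
    let G : (Fin m → ℂ) ≃ₗ[ℂ] (Fin m → ℂ) := LinearEquiv.ofLinear
      (Matrix.toLin' (g : Matrix (Fin m) (Fin m) ℂ))
      (Matrix.toLin' ((g⁻¹ : GL (Fin m) ℂ) : Matrix (Fin m) (Fin m) ℂ))
      (by rw [← Matrix.toLin'_mul, hgg, Matrix.toLin'_one])
      (by rw [← Matrix.toLin'_mul, hgg', Matrix.toLin'_one])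
    have hGcoe : (G : (Fin m → ℂ) →ₗ[ℂ] (Fin m → ℂ)) = Matrix.toLin' (g : Matrix (Fin m) (Fin m) ℂ) := rfl
    have hGsymm : (G.symm : (Fin m → ℂ) →ₗ[ℂ] (Fin m → ℂ)) =
        Matrix.toLin' ((g⁻¹ : GL (Fin m) ℂ) : Matrix (Fin m) (Fin m) ℂ) := rfl
    -- evaluated conjugation `B(a ∘ f) = g⁻¹ B(a) g`
    have hga : ∀ a : Fin n × Fin n → ℂ, B.map (MvPolynomial.eval (a ∘ Fr πρ)) =
        ((g⁻¹ : GL (Fin m) ℂ) : Matrix (Fin m) (Fin m) ℂ) * B.map (MvPolynomial.eval a) *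
          (g : Matrix (Fin m) (Fin m) ℂ) := by
      intro a
      rw [← map_rename_map_eval, hg', Matrix.map_mul, Matrix.map_mul, map_C_map_eval, map_C_map_eval]
    have hconj : ∀ a : Fin n × Fin n → ℂ, T a ∘ₗ (G : (Fin m → ℂ) →ₗ[ℂ] (Fin m → ℂ)) =
        (G : (Fin m → ℂ) →ₗ[ℂ] (Fin m → ℂ)) ∘ₗ T (a ∘ Fr πρ) := by
      intro a
      rw [hGcoe]
      show Matrix.toLin' (B.map (MvPolynomial.eval a)) ∘ₗ _ =
        _ ∘ₗ Matrix.toLin' (B.map (MvPolynomial.eval (a ∘ Fr πρ)))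
      rw [← Matrix.toLin'_mul, ← Matrix.toLin'_mul, hga, ← Matrix.mul_assoc, ← Matrix.mul_assoc, hgg,
        Matrix.one_mul]
    have hdetf : MvPolynomial.rename (Fr πρ) B.det = B.det := by
      rw [AlgHom.map_det, AlgHom.mapMatrix_apply, hg', Matrix.det_mul, Matrix.det_mul, mul_right_comm,
        ← Matrix.det_mul, ← Matrix.map_mul, hgg', Matrix.map_one _ (map_zero _) (map_one _),
        Matrix.det_one, one_mul]
    obtain ⟨hGW, hGU⟩ := htrans G (Fr πρ) hconj hdetf
    have hGW' : Wst ≤ Wst.comap (G : (Fin m → ℂ) →ₗ[ℂ] (Fin m → ℂ)) :=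
      Submodule.map_le_iff_le_comap.mp hGW.le
    have hGU' : U ≤ U.comap (G : (Fin m → ℂ) →ₗ[ℂ] (Fin m → ℂ)) :=
      Submodule.map_le_iff_le_comap.mp hGU.le
    have hGsW : Wst ≤ Wst.comap (G.symm : (Fin m → ℂ) →ₗ[ℂ] (Fin m → ℂ)) := by
      intro w hw
      rw [Submodule.mem_comap]
      rw [← hGW] at hw
      obtain ⟨w', hw', rfl⟩ := hw
      simpa using hw'
    have hGsU : U ≤ U.comap (G.symm : (Fin m → ℂ) →ₗ[ℂ] (Fin m → ℂ)) := by
      intro w hw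
      rw [Submodule.mem_comap]
      rw [← hGU] at hw
      obtain ⟨w', hw', rfl⟩ := hw
      simpa using hw'
    have hι : ∀ c : C, C.subtype c ∈ Wst := fun c => hCW c.2
    set Gc : C →ₗ[ℂ] C := πC ∘ₗ (G : (Fin m → ℂ) →ₗ[ℂ] (Fin m → ℂ)) ∘ₗ C.subtype with hGc
    set Gc' : C →ₗ[ℂ] C := πC ∘ₗ (G.symm : (Fin m → ℂ) →ₗ[ℂ] (Fin m → ℂ)) ∘ₗ C.subtype with hGc'
    have hGG : (G : (Fin m → ℂ) →ₗ[ℂ] (Fin m → ℂ)) ∘ₗ (G.symm : (Fin m → ℂ) →ₗ[ℂ] (Fin m → ℂ)) =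
        LinearMap.id := by
      ext x; simp
    have hGG' : (G.symm : (Fin m → ℂ) →ₗ[ℂ] (Fin m → ℂ)) ∘ₗ (G : (Fin m → ℂ) →ₗ[ℂ] (Fin m → ℂ)) =
        LinearMap.id := by
      ext x; simp
    have h1 : Gc ∘ₗ Gc' = LinearMap.id := by
      rw [hGc, hGc', ← compression_comp πC C.subtype hι hπU hπW _ _ hGU' hGsW, hGG, LinearMap.id_comp]
      exact compression_id πC C.subtype hπC
    have h2 : Gc' ∘ₗ Gc = LinearMap.id := by
      rw [hGc, hGc', ← compression_comp πC C.subtype hι hπU hπW _ _ hGsU hGW', hGG', LinearMap.id_comp]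
      exact compression_id πC C.subtype hπC
    have h3 : ∀ a : Fin n × Fin n → ℂ, (πC ∘ₗ T a ∘ₗ C.subtype) ∘ₗ Gc =
        Gc ∘ₗ (πC ∘ₗ T (a ∘ Fr πρ) ∘ₗ C.subtype) := by
      intro a
      rw [hGc, ← compression_comp πC C.subtype hι hπU hπW (T a) _ (hU a) hGW',
        ← compression_comp πC C.subtype hι hπU hπW _ (T (a ∘ Fr πρ)) hGU' (hWst _), hconj a]
    set h₀ : Matrix (Fin m₀) (Fin m₀) ℂ := LinearMap.toMatrix bC bC Gc with hh₀
    set h₀' : Matrix (Fin m₀) (Fin m₀) ℂ := LinearMap.toMatrix bC bC Gc' with hh₀'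
    have hh1 : h₀ * h₀' = 1 := by
      rw [hh₀, hh₀', ← LinearMap.toMatrix_comp bC bC bC, h1, LinearMap.toMatrix_id]
    have hh2 : h₀' * h₀ = 1 := by
      rw [hh₀, hh₀', ← LinearMap.toMatrix_comp bC bC bC, h2, LinearMap.toMatrix_id]
    have hMconj : ∀ a : Fin n × Fin n → ℂ,
        LinearMap.toMatrix bC bC (πC ∘ₗ T a ∘ₗ C.subtype) * h₀ =
          h₀ * LinearMap.toMatrix bC bC (πC ∘ₗ T (a ∘ Fr πρ) ∘ₗ C.subtype) := by
      intro a
      rw [hh₀, ← LinearMap.toMatrix_comp bC bC bC, ← LinearMap.toMatrix_comp bC bC bC, h3 a]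
    have hdeth : h₀.det * h₀'.det = 1 := by rw [← Matrix.det_mul, hh1, Matrix.det_one]
    have hdeth0 : h₀.det ≠ 0 := left_ne_zero_of_mul_eq_one hdeth
    obtain ⟨ν, hν⟩ := IsAlgClosed.exists_pow_nat_eq ((h₀.det)⁻¹ : ℂ) hm₀pos
    have hν0 : ν ≠ 0 := by
      rintro rfl
      rw [zero_pow hm₀pos.ne'] at hν
      exact inv_ne_zero hdeth0 hν.symm
    let k : GL (Fin m₀) ℂ :=
      ⟨ν • h₀, ν⁻¹ • h₀',
        by rw [smul_mul_smul_comm, mul_inv_cancel₀ hν0, one_smul, hh1],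
        by rw [smul_mul_smul_comm, inv_mul_cancel₀ hν0, one_smul, hh2]⟩
    refine ⟨k, ?_, ?_⟩
    · apply matrix_eq_of_forall_map_eval_eq
      intro a
      rw [map_rename_map_eval, hB₀eval, Matrix.map_mul, Matrix.map_mul, map_C_map_eval,
        map_C_map_eval, hB₀eval]
      show lam • LinearMap.toMatrix bC bC (πC ∘ₗ T (a ∘ Fr πρ) ∘ₗ C.subtype) =
        (ν⁻¹ • h₀') * (lam • LinearMap.toMatrix bC bC (πC ∘ₗ T a ∘ₗ C.subtype)) * (ν • h₀)
      rw [smul_mul_smul_comm, smul_mul_smul_comm, Matrix.mul_assoc, hMconj a, ← Matrix.mul_assoc, hh2,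
        Matrix.one_mul, mul_right_comm, inv_mul_cancel₀ hν0, one_mul]
    · show Matrix.det (ν • h₀) = 1
      rw [Matrix.det_smul, Fintype.card_fin, hν, inv_mul_cancel₀ hdeth0]
  obtain ⟨F, hF⟩ := mkF m₀ B₀
  refine ⟨m₀, hm₀le, B₀, F, ⟨hB₀aff, hB₀det⟩, ?_, ?_, ?_, ?_⟩
  · intro π ρ
    obtain ⟨k, hk, hkd⟩ := hlift (π, ρ)
    exact ⟨k, (hF _).2 ⟨hk, hkd⟩⟩
  · -- scalar fibre over `(1,1)`: Schur
    intro h hh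
    obtain ⟨hh1, -⟩ := (hF _).1 hh
    have hh1' : B₀ = ((h⁻¹ : GL (Fin m₀) ℂ) : Matrix (Fin m₀) (Fin m₀) ℂ).map MvPolynomial.C * B₀ *
        (h : Matrix (Fin m₀) (Fin m₀) ℂ).map MvPolynomial.C := by
      have := hh1
      rw [show ((1 : Equiv.Perm (Fin n) × Equiv.Perm (Fin n)), h).1 = 1 from rfl, hFr_one,
        MvPolynomial.rename_id] at this
      simpa only [AlgHom.coe_id, Matrix.map_id] using this
    have hhh : (h : Matrix (Fin m₀) (Fin m₀) ℂ) * ((h⁻¹ : GL (Fin m₀) ℂ) : Matrix (Fin m₀) (Fin m₀) ℂ) = 1 :=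
      Units.mul_inv h
    have hcomm : ∀ a : Fin n × Fin n → ℂ,
        (h : Matrix (Fin m₀) (Fin m₀) ℂ) * LinearMap.toMatrix bC bC (πC ∘ₗ T a ∘ₗ C.subtype) =
          LinearMap.toMatrix bC bC (πC ∘ₗ T a ∘ₗ C.subtype) * (h : Matrix (Fin m₀) (Fin m₀) ℂ) := by
      intro a
      have := congrArg (fun M => (h : Matrix (Fin m₀) (Fin m₀) ℂ) * M.map (MvPolynomial.eval a)) hh1'
      rw [Matrix.map_mul, Matrix.map_mul, map_C_map_eval, map_C_map_eval, ← Matrix.mul_assoc,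
        ← Matrix.mul_assoc, hhh, Matrix.one_mul, hB₀eval, mul_smul_comm, smul_mul_assoc] at this
      exact smul_right_injective _ hlamne this
    set Hc : C →ₗ[ℂ] C := Matrix.toLin bC bC (h : Matrix (Fin m₀) (Fin m₀) ℂ) with hHc
    have hHcomm : ∀ a : Fin n × Fin n → ℂ,
        (πC ∘ₗ T a ∘ₗ C.subtype) ∘ₗ Hc = Hc ∘ₗ (πC ∘ₗ T a ∘ₗ C.subtype) := by
      intro a
      apply (LinearMap.toMatrix bC bC).injective
      rw [LinearMap.toMatrix_comp bC bC bC, LinearMap.toMatrix_comp bC bC bC, hHc,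
        LinearMap.toMatrix_toLin, hcomm a]
    obtain ⟨μ, hμ⟩ := compression_schur T hUlt hCW πC hπC hπU hπW hdim hWst hU
      (fun W hW _ hlt => hUmax W hW hlt) Hc hHcomm
    refine ⟨μ, ?_⟩
    have : LinearMap.toMatrix bC bC Hc = μ • (1 : Matrix (Fin m₀) (Fin m₀) ℂ) := by
      rw [hμ, map_smul, LinearMap.toMatrix_id]
    rwa [hHc, LinearMap.toMatrix_toLin] at this
  · intro x hx; exact ((hF x).1 hx).2
  · intro x hx; exact ((hF x).1 hx).1

end Assembly

end Summit.ValiantsHypothesis.ValiantsHypothesis.Theorems.SymPencilEquivariantSdcNotQP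

end
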